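import Summits.KontsevichZagierPeriods.KontsevichZagierPeriods.Theses.SpectrahedralScissors
import Summits.KontsevichZagierPeriods.KontsevichZagierPeriods.Theorems.BetaCancellation.Negative.Torsion
import Literature.NumberTheory.Transcendental.KZKernelConjectureForms
import Literature.NumberTheory.Transcendental.KZLogCalculusProofs

/-!
# KontsevichZagierPeriods / SpectrahedralScissors — the strength of the crux `SeparabilityKernel`
# (item stmt-KontsevichZagierPeriods-9263; helper file, `--supports … --as helper`)

**Theorem (finite enlargements of the KZ calculus are inert).** Let `F ⊆ KZ.FormalRep` be ANY set of
formal combinations whose image in the formal period group `KZ.FormalRep ⧸ KZ.relations` is finite.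
If the kernel of evaluation is contained in the subgroup generated by the four move sets together with
`F`, then it is already contained in `KZ.relations`:

  `(∀ c, eval c = 0 → c ∈ closure (moves ∪ F)) → KZKernelConjecture`
  (`kzKernelConjecture_of_kernel_le_closure_union`).

No hypothesis on the VALUES of the members of `F` is needed. Proof (one paragraph): the formal period
group `P := FormalRep ⧸ relations` is DIVISIBLE (`[σ, f] ≡ N • [σ, f/N]`, rule (1b); tree theorem
`BetaCancellationNegative.exists_nsmul_sub_mem_relations`) and TORSION-FREE (tree theorem
`BetaCancellationNegative.zsmul_mem_relations_iff`). Let `A ≤ P` be the (finitely generated) span of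
the image of `F`; the hypothesis says `π(ker eval) ≤ A`. Given `c ∈ ker eval` and `N ≥ 1`, write
`c ≡ N • y`; soundness gives `eval y = 0`, so `π y ∈ A` and `π c = N • π y`: the class `π c` is
divisible by every `N` INSIDE the finitely generated torsion-free — hence free — group `A`, so all its
coordinates in a `ℤ`-basis are divisible by every `N`, i.e. `π c = 0`, i.e. `c ∈ relations`.

**Corollary (the crux is the summit).** The two separability relator sets of `SeparabilityKernel`
(`[P_ℝ, 64] − [D_ℝ, 29]`, `[P_ℂ, 33] − [D_ℂ, 8]`, literal bodies of the route decl) have at most ONE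
class each modulo `KZ.relations` (two representations with the same domain whose integrands agree on
it are congruent, `KZ.of_sub_of_mem_relations_of_eqOn`), so the theorem applies:
`SeparabilityKernel → KZKernelConjecture` (`kzKernelConjecture_of_separabilityKernel`), and with the
landed `kzKernelConjecture_iff_isRational` and monotonicity of `closure`:

  `separabilityKernel_iff_kontsevichZagierPeriods : SeparabilityKernel ↔ KontsevichZagierPeriods`.

So the rank-0 target of route SpectrahedralScissors is LITERALLY EQUIVALENT to the summit; the
instances `Rebit2964 ∧ Qubit833` (hypotheses `QubitCore833`, `RebitCore2964`, `Transport` of the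
route's `closes`) are not load-bearing for it, and no strategy for this crux short of the summit can
exist. The same theorem applies verbatim to every "kernel form of an enlarged calculus" whose adjoined
relators have finitely many classes modulo the moves.

Sources: M. Kontsevich, D. Zagier, *Periods* (2001), §1.2 (rules (1)–(3), Conjecture 1);
A. Huber, S. Müller-Stach, *Periods and Nori Motives* (2017), Conj. 13.2.1 (kernel form).
The group theory is folklore (a finitely generated torsion-free abelian group is free, Mathlib
`Module.free_of_finite_type_torsion_free'`; an integer divisible by every positive integer is `0`).
This file introduces no definitions.
-/

noncomputable section

namespace Summit.KontsevichZagierPeriods.SpectrahedralScissors.SeparabilityKernelStrength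

open scoped BigOperators Matrix ComplexOrder
open Set
open Literature.NumberTheory.Transcendental Literature.NumberTheory.Transcendental.KZ

/-! ## Folklore group theory: no non-zero element of a finitely generated torsion-free abelian
group is divisible by every positive integer -/

/-- An integer divisible by every positive natural number is `0`. [folklore] -/
theorem int_eq_zero_of_forall_dvd (z : ℤ) (h : ∀ N : ℕ, 0 < N → (N : ℤ) ∣ z) : z = 0 := by
  have hd : z.natAbs + 1 ∣ z.natAbs := Int.natCast_dvd.mp (h (z.natAbs + 1) (Nat.succ_pos _))
  exact Int.natAbs_eq_zero.mp (Nat.eq_zero_of_dvd_of_lt hd (Nat.lt_succ_self _))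

/-- In a torsion-free `ℤ`-module, an element of the `ℤ`-span `A` of a FINITE set which is divisible
INSIDE `A` by every positive integer is `0`: `A` is finitely generated and torsion-free, hence free
(`Module.free_of_finite_type_torsion_free'`), and every coordinate of the element in a basis is an
integer divisible by every `N`. [folklore] -/
theorem eq_zero_of_forall_exists_nsmul_of_finite {Q : Type*} [AddCommGroup Q]
    [NoZeroSMulDivisors ℤ Q] {S : Set Q} (hS : S.Finite) {x : Q}
    (hx : ∀ N : ℕ, 0 < N → ∃ y ∈ Submodule.span ℤ S, x = N • y) : x = 0 := by
  set A : Submodule ℤ Q := Submodule.span ℤ S with hA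
  haveI : Module.Finite ℤ A := Module.Finite.iff_fg.mpr (Submodule.fg_span hS)
  haveI : Module.Free ℤ A := Module.free_of_finite_type_torsion_free'
  obtain ⟨y₁, hy₁, hxy₁⟩ := hx 1 Nat.one_pos
  have hxA : x ∈ A := by rw [hxy₁, one_nsmul]; exact hy₁
  let b := Module.Free.chooseBasis ℤ A
  -- every coordinate of `⟨x, hxA⟩` is divisible by every positive integer
  have hcoord : ∀ i, b.repr ⟨x, hxA⟩ i = 0 := by
    intro i
    refine int_eq_zero_of_forall_dvd _ fun N hN => ?_
    obtain ⟨y, hy, hxy⟩ := hx N hN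
    have hsub : (⟨x, hxA⟩ : A) = N • (⟨y, hy⟩ : A) := by
      apply Subtype.ext
      simp [hxy]
    refine ⟨b.repr ⟨y, hy⟩ i, ?_⟩
    rw [hsub, map_nsmul, Finsupp.coe_nsmul, Pi.smul_apply, nsmul_eq_mul]
  have hzero : (⟨x, hxA⟩ : A) = 0 := by
    apply b.repr.injective
    rw [map_zero]
    ext i
    rw [hcoord i, Finsupp.zero_apply]
  simpa using congrArg Subtype.val hzero

/-! ## The formal period group `KZ.FormalRep ⧸ KZ.relations` is torsion-free -/

/-- `FormalRep ⧸ relations` is torsion-free (tree theorem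
`BetaCancellationNegative.zsmul_mem_relations_iff`: `k • x ∈ relations ↔ x ∈ relations`, `k ≠ 0`).
Stated as a theorem (a `Prop`-valued class), used below via `haveI`. [folklore] -/
theorem noZeroSMulDivisors_int_quotient_relations :
    NoZeroSMulDivisors ℤ (KZ.FormalRep ⧸ KZ.relations) where
  eq_zero_or_eq_zero_of_smul_eq_zero := by
    intro k x h
    by_cases hk : k = 0
    · exact Or.inl hk
    · right
      induction x using QuotientAddGroup.induction_on with
      | H c =>
        have h' : ((k • c : KZ.FormalRep) : KZ.FormalRep ⧸ KZ.relations) = 0 := by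
          rw [QuotientAddGroup.mk_zsmul]; exact h
        rw [QuotientAddGroup.eq_zero_iff] at h' ⊢
        exact (Summit.KontsevichZagierPeriods.KontsevichZagierPeriods.BetaCancellationNegative.zsmul_mem_relations_iff
          hk c).1 h'

/-! ## The main theorem: finite enlargements are inert -/

/-- **Finite enlargements of the KZ calculus are inert.** If every vanishing formal combination lies
in the subgroup generated by the four move sets and a set `F` whose image modulo `KZ.relations` is
finite, then every vanishing formal combination already lies in `KZ.relations`, i.e. the kernel form
of the period conjecture holds. No hypothesis on the values of the members of `F`.
[cite: KontsevichZagier2001, §1.2 Conjecture 1] -/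
theorem kzKernelConjecture_of_kernel_le_closure_union {F : Set KZ.FormalRep}
    (hF : ((QuotientAddGroup.mk' KZ.relations) '' F).Finite)
    (h : ∀ c : KZ.FormalRep, KZ.eval c = 0 →
      c ∈ AddSubgroup.closure (KZ.domainAddRel ∪ KZ.integrandAddRel ∪ KZ.changeOfVariablesRel ∪
        KZ.newtonLeibnizRel ∪ F)) :
    KZKernelConjecture := by
  haveI := noZeroSMulDivisors_int_quotient_relations
  intro c hc
  -- the enlarged subgroup projects into the `ℤ`-span `A` of the (finite) image of `F`
  have hle : AddSubgroup.closure (KZ.domainAddRel ∪ KZ.integrandAddRel ∪ KZ.changeOfVariablesRel ∪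
      KZ.newtonLeibnizRel ∪ F) ≤
      ((Submodule.span ℤ ((QuotientAddGroup.mk' KZ.relations) '' F)).toAddSubgroup).comap
        (QuotientAddGroup.mk' KZ.relations) := by
    refine (AddSubgroup.closure_le _).mpr ?_
    rintro x (hx | hx)
    · -- a move: its class is `0`
      have hx' : x ∈ KZ.relations := AddSubgroup.subset_closure hx
      have h0 : QuotientAddGroup.mk' KZ.relations x = 0 := (QuotientAddGroup.eq_zero_iff x).mpr hx'
      rw [SetLike.mem_coe, AddSubgroup.mem_comap, Submodule.mem_toAddSubgroup, h0]
      exact Submodule.zero_mem _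
    · rw [SetLike.mem_coe, AddSubgroup.mem_comap, Submodule.mem_toAddSubgroup]
      exact Submodule.subset_span ⟨x, hx, rfl⟩
  -- the class of `c` is divisible by every `N` inside `A`
  have hdiv : ∀ N : ℕ, 0 < N → ∃ y ∈ Submodule.span ℤ ((QuotientAddGroup.mk' KZ.relations) '' F),
      QuotientAddGroup.mk' KZ.relations c = N • y := by
    intro N hN
    obtain ⟨y, hy⟩ :=
      Summit.KontsevichZagierPeriods.KontsevichZagierPeriods.BetaCancellationNegative.exists_nsmul_sub_mem_relations
        (Nat.pos_iff_ne_zero.mp hN) c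
    -- soundness: `eval y = 0`
    have hy0 : KZ.eval y = 0 := by
      have h0 : KZ.eval (c - N • y) = 0 := KZ.relations_le_ker_eval_holds hy
      rw [map_sub, map_nsmul, hc, zero_sub, neg_eq_zero, smul_eq_zero] at h0
      exact h0.resolve_left (Nat.pos_iff_ne_zero.mp hN)
    have hyA := hle (h y hy0)
    rw [AddSubgroup.mem_comap, Submodule.mem_toAddSubgroup] at hyA
    refine ⟨QuotientAddGroup.mk' KZ.relations y, hyA, ?_⟩
    have : QuotientAddGroup.mk' KZ.relations (c - N • y) = 0 := (QuotientAddGroup.eq_zero_iff _).mpr hy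
    rwa [map_sub, map_nsmul, sub_eq_zero] at this
  have h0 : QuotientAddGroup.mk' KZ.relations c = 0 := eq_zero_of_forall_exists_nsmul_of_finite hF hdiv
  exact (QuotientAddGroup.eq_zero_iff c).mp h0

/-! ## Relator sets with one class modulo the moves -/

/-- Two differences `[r₁] − [r₁']`, `[r₂] − [r₂']` of representations with pairwise equal domains
and integrands agreeing on them are congruent modulo the moves. [cite: KontsevichZagier2001, §1.2 rule (1)] -/
theorem sub_sub_sub_mem_relations {n : ℕ} {r₁ r₁' r₂ r₂' : KZ.IntegralRep n}
    (hd : r₂.domain = r₁.domain) (hi : EqOn r₁.integrand r₂.integrand r₁.domain)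
    (hd' : r₂'.domain = r₁'.domain) (hi' : EqOn r₁'.integrand r₂'.integrand r₁'.domain) :
    (KZ.of r₁ - KZ.of r₁') - (KZ.of r₂ - KZ.of r₂') ∈ KZ.relations := by
  have h1 := KZ.of_sub_of_mem_relations_of_eqOn hd hi
  have h2 := KZ.of_sub_of_mem_relations_of_eqOn hd' hi'
  have : (KZ.of r₁ - KZ.of r₁') - (KZ.of r₂ - KZ.of r₂') =
      (KZ.of r₁ - KZ.of r₂) - (KZ.of r₁' - KZ.of r₂') := by abel
  rw [this]
  exact KZ.relations.sub_mem h1 h2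

/-- Two differences `[r₁] − [r₁']`, `[r₂] − [r₂']` of representations with CONSTANT integrands
`a`, `b` on pairwise equal domains are congruent modulo the moves — the shape of both relator sets of
the crux. [cite: KontsevichZagier2001, §1.2 rule (1)] -/
theorem sub_sub_sub_mem_relations_of_const {n : ℕ} {r₁ r₁' r₂ r₂' : KZ.IntegralRep n}
    {D D' : Set (Fin n → ℝ)} {a b : ℝ}
    (hd₁ : r₁.domain = D) (hi₁ : EqOn r₁.integrand (fun _ => a) r₁.domain)
    (hd₁' : r₁'.domain = D') (hi₁' : EqOn r₁'.integrand (fun _ => b) r₁'.domain)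
    (hd₂ : r₂.domain = D) (hi₂ : EqOn r₂.integrand (fun _ => a) r₂.domain)
    (hd₂' : r₂'.domain = D') (hi₂' : EqOn r₂'.integrand (fun _ => b) r₂'.domain) :
    (KZ.of r₁ - KZ.of r₁') - (KZ.of r₂ - KZ.of r₂') ∈ KZ.relations := by
  have hd : r₂.domain = r₁.domain := hd₂.trans hd₁.symm
  have hd' : r₂'.domain = r₁'.domain := hd₂'.trans hd₁'.symm
  refine sub_sub_sub_mem_relations hd ?_ hd' ?_
  · intro x hx
    rw [hi₁ hx, hi₂ (hd ▸ hx)]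
  · intro x hx
    rw [hi₁' hx, hi₂' (hd' ▸ hx)]

/-- A set of formal combinations any two of which are congruent has at most one class modulo the
moves. [folklore] -/
theorem subsingleton_image_mk_of_forall_sub_mem {F : Set KZ.FormalRep}
    (hF : ∀ c₁ ∈ F, ∀ c₂ ∈ F, c₁ - c₂ ∈ KZ.relations) :
    ((QuotientAddGroup.mk' KZ.relations) '' F).Subsingleton := by
  rintro _ ⟨c₁, hc₁, rfl⟩ _ ⟨c₂, hc₂, rfl⟩
  exact (QuotientAddGroup.eq_iff_sub_mem).mpr (hF c₁ hc₁ c₂ hc₂)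

/-! ## The strength of the crux -/

/-- **`SeparabilityKernel → KZKernelConjecture`**: the enlarged kernel form with the two separability
relator sets adjoined implies the plain kernel form of the period conjecture — each relator set has a
single class modulo the moves (its members share their domains, by `funext` on the density-matrix
clauses, and their constant integrands), so finite enlargements being inert applies.
[cite: KontsevichZagier2001, §1.2 Conjecture 1] -/
theorem kzKernelConjecture_of_separabilityKernel
    (h : Summit.KontsevichZagierPeriods.KontsevichZagierPeriods.Theses.SpectrahedralScissors.SeparabilityKernel) :
    KZKernelConjecture := by
  refine kzKernelConjecture_of_kernel_le_closure_union ?_ h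
  rw [image_union]
  refine (subsingleton_image_mk_of_forall_sub_mem ?_).finite.union
    (subsingleton_image_mk_of_forall_sub_mem ?_).finite
  · rintro _ ⟨ρ₁, ρ₁', r₁, r₁', hρ₁, hρ₁', hd₁, hi₁, hd₁', hi₁', rfl⟩
      _ ⟨ρ₂, ρ₂', r₂, r₂', hρ₂, hρ₂', hd₂, hi₂, hd₂', hi₂', rfl⟩
    have eρ : ρ₂ = ρ₁ := funext fun y => (hρ₂ y).trans (hρ₁ y).symm
    have eρ' : ρ₂' = ρ₁' := funext fun y => (hρ₂' y).trans (hρ₁' y).symm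
    subst eρ eρ'
    exact sub_sub_sub_mem_relations_of_const hd₁ hi₁ hd₁' hi₁' hd₂ hi₂ hd₂' hi₂'
  · rintro _ ⟨ρ₁, ρ₁', r₁, r₁', hρ₁, hρ₁', hd₁, hi₁, hd₁', hi₁', rfl⟩
      _ ⟨ρ₂, ρ₂', r₂, r₂', hρ₂, hρ₂', hd₂, hi₂, hd₂', hi₂', rfl⟩
    have eρ : ρ₂ = ρ₁ := funext fun y => (hρ₂ y).trans (hρ₁ y).symm
    have eρ' : ρ₂' = ρ₁' := funext fun y => (hρ₂' y).trans (hρ₁' y).symm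
    subst eρ eρ'
    exact sub_sub_sub_mem_relations_of_const hd₁ hi₁ hd₁' hi₁' hd₂ hi₂ hd₂' hi₂'

/-- **`KZKernelConjecture → SeparabilityKernel`** (monotonicity of `closure`; the route's own
`SectorOfSummit` (a)). [cite: KontsevichZagier2001, §1.2 Conjecture 1] -/
theorem separabilityKernel_of_kzKernelConjecture (h : KZKernelConjecture) :
    Summit.KontsevichZagierPeriods.KontsevichZagierPeriods.Theses.SpectrahedralScissors.SeparabilityKernel := by
  intro c hc
  exact AddSubgroup.closure_mono subset_union_left (h c hc)

/-- **The crux is the kernel form of the summit.** [cite: KontsevichZagier2001, §1.2 Conjecture 1] -/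
theorem separabilityKernel_iff_kzKernelConjecture :
    Summit.KontsevichZagierPeriods.KontsevichZagierPeriods.Theses.SpectrahedralScissors.SeparabilityKernel ↔
      KZKernelConjecture :=
  ⟨kzKernelConjecture_of_separabilityKernel, separabilityKernel_of_kzKernelConjecture⟩

/-- **`SeparabilityKernel → KontsevichZagierPeriods`**: the crux ALONE decides the summit — the
instance hypotheses `QubitCore833`, `RebitCore2964`, `Transport` of the route's `closes` are not
needed. [cite: KontsevichZagier2001, §1.2 Conjecture 1] -/
theorem kontsevichZagierPeriods_of_separabilityKernel
    (h : Summit.KontsevichZagierPeriods.KontsevichZagierPeriods.Theses.SpectrahedralScissors.SeparabilityKernel) :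
    KontsevichZagierPeriods :=
  kzKernelConjecture_iff_isRational.mp (kzKernelConjecture_of_separabilityKernel h)

/-- **`KontsevichZagierPeriods → SeparabilityKernel`** (the summit implies the crux outright).
[cite: KontsevichZagier2001, §1.2 Conjecture 1] -/
theorem separabilityKernel_of_kontsevichZagierPeriods (h : KontsevichZagierPeriods) :
    Summit.KontsevichZagierPeriods.KontsevichZagierPeriods.Theses.SpectrahedralScissors.SeparabilityKernel :=
  separabilityKernel_of_kzKernelConjecture (kzKernelConjecture_iff_isRational.mpr h)

/-- **THE CRUX IS THE SUMMIT**: `SeparabilityKernel ↔ KontsevichZagierPeriods` — item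
stmt-KontsevichZagierPeriods-9263 is literally equivalent to the problem statement (summit-strength
certificate for the tribunal, T1 (b): landed equivalence). [cite: KontsevichZagier2001, §1.2 Conjecture 1] -/
theorem separabilityKernel_iff_kontsevichZagierPeriods :
    Summit.KontsevichZagierPeriods.KontsevichZagierPeriods.Theses.SpectrahedralScissors.SeparabilityKernel ↔
      KontsevichZagierPeriods :=
  ⟨kontsevichZagierPeriods_of_separabilityKernel, separabilityKernel_of_kontsevichZagierPeriods⟩

end Summit.KontsevichZagierPeriods.SpectrahedralScissors.SeparabilityKernelStrength
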